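import Summits.QuantumFields.YangMills.Theorems.ParabolicTrajectoryContinuumLimitOnTrajectoryRegimeTrisection
import Summits.QuantumFields.YangMills.Theorems.ParabolicTrajectoryContinuumLimitOnTrajectoryDefsG

/-!
# Route `ParabolicTrajectory`, crux `ContinuumLimitOnTrajectory` (stmt-QuantumFields-10522): line `regime-trisection` — the route's deciding theorem after the split, pre-certified

Lead seat c8. The registered line `regime-trisection` splits (A) `ContinuumLimitOnTrajectory` into V `ForcedVolumeGrowth`
(artefact, to be dropped), I `ClusteringOnTrajectory` (infrared bridge) and U `UltravioletLimitOnTrajectory` (pure UV crux)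
(`…RegimeTrisection`, p152397). The crux-strategist's route repair (`Cruxes/ContinuumLimitOnTrajectory/STRATEGY-CENSUS.md` §6.2)
is then: restate (S) `TunedSequenceExists` as `TunedSequenceExistsPVG` (`…DefsG` §1: the growth clause appended to its
CONCLUSION — the constructor of tuned sequences chooses the volumes), re-glue the deciding theorem to `U → I → (B) → (S_PVG) →
YangMills`, and drop V together with the parent (A). This file kernel-checks that deciding theorem BEFORE the edit, so the rev-8
`--closes-file` is a one-line term:

* `yangMills_of_subs : UltravioletLimitOnTrajectory → ClusteringOnTrajectory → LatticeGapOnTrajectory → TunedSequenceExistsPVG → YangMills`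
  — `…DefsG.closesPVG` composed with `continuumLimitOnTrajectoryPVG_of_subs` (the two honest children give (A_PVG)); V is NOT used;
* `yangMills_of_subs_of_crux` — the same with (A) as typed in place of U (consistency: the rev-7 route loses nothing);
* `yangMills_of_splitInputs : ChartExists → UVPhysics345 → ClusteringOnTrajectory → LatticeGapOnTrajectory → TunedSequenceExistsPVG →
  YangMills` — the whole repaired route modulo the two UV statements of child U (`ultravioletLimitOnTrajectory_of_inputs`), child I,
  crux (B) and the repaired (S);
* `yangMills_of_allSubs : ForcedVolumeGrowth → ClusteringOnTrajectory → UltravioletLimitOnTrajectory → LatticeGapOnTrajectory →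
  TunedSequenceExists → YangMills` — with the artefact V the CURRENT rev-7 deciding theorem `closes` is reached from the three
  children and (B), (S) as typed (what the split alone, without the restatement of (S), leaves as the route's closure).

Refs: `…DefsG` (`TunedSequenceExistsPVG`, `closesPVG`), `…DefsF` (`ContinuumLimitOnTrajectoryPVG`), `…RegimeTrisection`
(children, split glue, UV reduction); STRATEGY-CENSUS §6; LEAD-SUMMARY §1b/§4.
-/

set_option autoImplicit false

open Summit.QuantumFields.YangMills.Theses.ParabolicTrajectory
open Summit.QuantumFields.YangMills.Cruxes.ContinuumLimitOnTrajectory.TwoOrbitSynchronisation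

namespace Summit.QuantumFields.YangMills.Cruxes.ContinuumLimitOnTrajectory.RegimeTrisection

/-- **The repaired route's deciding theorem, pre-certified**: the pure-UV child U, the infrared child I, crux (B) as typed and
the repaired (S) `TunedSequenceExistsPVG` imply the sub-problem statement `YangMills`. Proof: I and U give the restated crux
(A_PVG) (`continuumLimitOnTrajectoryPVG_of_subs`), and `closesPVG` (`…DefsG`) is the rev-7 `closes` rethreaded with the growth
clause passed from the conclusion of (S_PVG) to the extra hypothesis of (A_PVG). The artefact child V is not used. -/
theorem yangMills_of_subs :
    UltravioletLimitOnTrajectory → ClusteringOnTrajectory → LatticeGapOnTrajectory → TunedSequenceExistsPVG → YangMills :=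
  fun hU hI => closesPVG (continuumLimitOnTrajectoryPVG_of_subs hI hU)

/-- Consistency with the route as typed: (A) implies U (`ultravioletLimitOnTrajectory_of_crux`), so the repaired deciding
theorem also runs from (A), I, (B), (S_PVG). -/
theorem yangMills_of_subs_of_crux :
    ContinuumLimitOnTrajectory → ClusteringOnTrajectory → LatticeGapOnTrajectory → TunedSequenceExistsPVG → YangMills :=
  fun hA => yangMills_of_subs (ultravioletLimitOnTrajectory_of_crux hA)

/-- **The whole repaired route modulo named statements**: Bałaban's two-orbit chart `ChartExists` and the volume-uniform UV
engine `UVPhysics345` (child U's two inputs, `ultravioletLimitOnTrajectory_of_inputs`), the infrared child I, crux (B) and the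
repaired (S). -/
theorem yangMills_of_splitInputs :
    ChartExists → UVPhysics345 → ClusteringOnTrajectory → LatticeGapOnTrajectory → TunedSequenceExistsPVG → YangMills :=
  fun hchart huv => yangMills_of_subs (ultravioletLimitOnTrajectory_of_inputs hchart huv)

/-- **What the split alone leaves as the route's closure** (before (S) is restated): the three children and (B), (S) as typed
reach `YangMills` through the CURRENT rev-7 deciding theorem `closes`, the artefact V supplying the growth clause that (S) as
typed does not deliver. -/
theorem yangMills_of_allSubs :
    ForcedVolumeGrowth → ClusteringOnTrajectory → UltravioletLimitOnTrajectory → LatticeGapOnTrajectory →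
      TunedSequenceExists → YangMills :=
  fun hV hI hU => closes (ContinuumLimitOnTrajectory_of_subs hV hI hU)

end Summit.QuantumFields.YangMills.Cruxes.ContinuumLimitOnTrajectory.RegimeTrisection
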